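import Literature.NumberTheory.LFunctions.KloostermanPrimePowerTools
import HarnessLib

/-!
# Route `PrimeLevelFamEdge`, crux K_A `MomentsBeyondDiagonal` (stmt-Parity-20007), line «petersson_layers» v4:
# the FOURIER-THEORETIC (completion / Parseval) bound for bilinear Kloosterman forms at a GENERAL modulus

For every modulus `c ≥ 1`, all finite sets `S, T ⊂ ℕ` whose elements are pairwise incongruent mod `c` (e.g.
`S = [1, U]`, `T = [1, V]` with `U, V ≤ c`) and all complex coefficients,

  `‖Σ_{u ∈ S} Σ_{v ∈ T} α_u β_v S(u, v; c)‖ ≤ c · ‖α‖₂ · ‖β‖₂`      (`norm_bilinear_kloostermanSum_le`).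

Proof: open `S(u,v;c) = Σ_{w ∈ (ℤ/c)ˣ} e((uw + v w̄)/c)`, so the form is `Σ_w A(w) B(w̄)` with the additive transforms
`A(x) = Σ_u α_u e(ux/c)`, `B(x) = Σ_v β_v e(vx/c)`; Cauchy–Schwarz over the units, `w ↦ w̄` a bijection, units ⊂ all
residues, and PLANCHEREL mod `c` (`sum_norm_sq_natTransform_eq`: `Σ_{x mod c} ‖A(x)‖² = c‖α‖₂²`, exact because the `u ∈ S`
are distinct mod `c`).  This is the «trivial bound (Fourier)» of Pascadi (GAFA 2026 = arXiv:2511.08445, (1.3)/(eq:trivial-bound))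
and of Kerr–Shparlinski–Wu–Xi 2023 §1.1, against which every bilinear Kloosterman saving is measured; for the line it is
(i) deck 21c's «(T1′) Parseval floor» made a theorem — applied to a Petersson layer `K_r` regrouped as a balanced form in
`(u, v) = (m₁'m₂', n₁'n₂')` (companion file `…LayersKloostermanProduct`) it gives the layer-block count `q̂^{Δ'} = q̂·√Y`
(deficit `√Y = q̂^{Δ'−1}`, flat in `r`), and (ii) the bound that funds, on a short window `Δ' ∈ (1, 1 + λ₀]`, the sub-sums of
a far/band layer whose variables carry a large `r`-part (where no coprimality `(m, n, c) = 1` is available for Thm 7.1):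
their `ℓ²`-mass is a negative power of the cut-off, and `√Y = q̂^{λ}` is then affordable.
Also recorded: the unit-sum bookkeeping (additive orthogonality mod `c` is Mathlib's `AddChar.sum_mulShift`, used inline).

Proof only (def-free helper toward `stub_farP` / `stub_band` / `stub_core`); no layer is bounded here; K_A NOT proved;
nothing about Landau–Siegel zeros.
-/

noncomputable section

open Finset
open Literature.NumberTheory.LFunctions

namespace Summit.Parity.GeneralizedHardyLittlewood.Theorems.MomentsBeyondDiagonal.Layers

variable {c : ℕ} [NeZero c]

/-! ## §1. Additive orthogonality and Plancherel modulo `c` -/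

/-- **Plancherel mod `c` for a table on distinct residues.** If the naturals `u ∈ S` are pairwise incongruent
mod `c`, then `Σ_{x mod c} ‖Σ_{u∈S} α_u e(ux/c)‖² = c · Σ_{u∈S} ‖α_u‖²`. [folklore] -/
theorem sum_norm_sq_natTransform_eq (S : Finset ℕ) (hS : Set.InjOn (fun u : ℕ ↦ (u : ZMod c)) S)
    (α : ℕ → ℂ) :
    ∑ x : ZMod c, ‖∑ u ∈ S, α u * (ZMod.stdAddChar ((u : ZMod c) * x) : ℂ)‖ ^ 2 =
      (c : ℝ) * ∑ u ∈ S, ‖α u‖ ^ 2 := by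
  classical
  set A : ZMod c → ℂ := fun x ↦ ∑ u ∈ S, α u * (ZMod.stdAddChar ((u : ZMod c) * x) : ℂ) with hA
  -- work in `ℂ`: expand `‖A x‖² = A x · conj (A x)` character by character
  have key : ∀ x : ZMod c, ((‖A x‖ : ℝ) : ℂ) ^ 2 =
      ∑ u ∈ S, ∑ u' ∈ S, α u * (starRingEnd ℂ) (α u') *
        (ZMod.stdAddChar (x * ((u : ZMod c) - (u' : ZMod c))) : ℂ) := by
    intro x
    rw [← Complex.ofReal_pow, ← Complex.normSq_eq_norm_sq, ← Complex.mul_conj, hA]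
    dsimp only
    rw [map_sum, Finset.sum_mul_sum]
    refine Finset.sum_congr rfl fun u _ ↦ Finset.sum_congr rfl fun u' _ ↦ ?_
    rw [map_mul (starRingEnd ℂ) (α u'), ← AddChar.map_neg_eq_conj]
    have hψ : (ZMod.stdAddChar ((u : ZMod c) * x) : ℂ) * ZMod.stdAddChar (-((u' : ZMod c) * x)) =
        ZMod.stdAddChar (x * ((u : ZMod c) - (u' : ZMod c))) := by
      rw [← AddChar.map_add_eq_mul]
      congr 1
      ring
    rw [← hψ]
    ring
  -- additive orthogonality mod `c` (Mathlib `AddChar.sum_mulShift` for the primitive character `ZMod.stdAddChar`)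
  have horth : ∀ b : ZMod c, ∑ x : ZMod c, (ZMod.stdAddChar (x * b) : ℂ) = if b = 0 then (c : ℂ) else 0 := by
    intro b
    rw [AddChar.sum_mulShift b (ZMod.isPrimitive_stdAddChar c), ZMod.card]
    split_ifs <;> simp
  have hsum : ∑ x : ZMod c, ((‖A x‖ : ℝ) : ℂ) ^ 2 = (c : ℂ) * ∑ u ∈ S, ((‖α u‖ : ℝ) : ℂ) ^ 2 := by
    simp_rw [key]
    rw [Finset.sum_comm, Finset.mul_sum]
    refine Finset.sum_congr rfl fun u hu ↦ ?_
    rw [Finset.sum_comm]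
    simp_rw [← Finset.mul_sum, horth, mul_ite, mul_zero]
    rw [Finset.sum_ite, Finset.sum_const_zero, add_zero]
    have hfilter : S.filter (fun x : ℕ ↦ (u : ZMod c) - ((x : ℕ) : ZMod c) = 0) = ({u} : Finset ℕ) := by
      ext x
      simp only [Finset.mem_filter, Finset.mem_singleton, sub_eq_zero]
      constructor
      · rintro ⟨hx, h⟩
        exact (hS (Finset.mem_coe.mpr hu) (Finset.mem_coe.mpr hx) h).symm
      · rintro rfl
        exact ⟨hu, rfl⟩
    rw [hfilter, Finset.sum_singleton, Complex.mul_conj, Complex.normSq_eq_norm_sq]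
    push_cast
    ring
  exact_mod_cast hsum

omit [NeZero c] in
/-- `[1, U]` injects into `ℤ/cℤ` when `U ≤ c`. [folklore] -/
theorem injOn_natCast_Icc {U : ℕ} (hU : U ≤ c) : Set.InjOn (fun u : ℕ ↦ (u : ZMod c)) (Icc 1 U : Finset ℕ) := by
  intro u hu u' hu' h
  simp only [coe_Icc, Set.mem_Icc] at hu hu'
  have h' : ((u - 1 : ℕ) : ZMod c) = ((u' - 1 : ℕ) : ZMod c) := by
    have h1 : (u : ZMod c) = (u' : ZMod c) := h
    rw [Nat.cast_sub hu.1, Nat.cast_sub hu'.1, h1]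
  rw [ZMod.natCast_eq_natCast_iff', Nat.mod_eq_of_lt (by omega), Nat.mod_eq_of_lt (by omega)] at h'
  omega

/-! ## §2. Unit-sum bookkeeping -/

/-- A sum over the unit group is at most the sum over all residues, for non-negative terms. [folklore] -/
theorem sum_units_le_sum {g : ZMod c → ℝ} (hg : ∀ x, 0 ≤ g x) :
    ∑ w : (ZMod c)ˣ, g (w : ZMod c) ≤ ∑ x : ZMod c, g x := by
  classical
  have h : ∑ w : (ZMod c)ˣ, g (w : ZMod c) =
      ∑ x ∈ (Finset.univ : Finset (ZMod c)ˣ).map ⟨((↑) : (ZMod c)ˣ → ZMod c), Units.val_injective⟩, g x := by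
    rw [Finset.sum_map]
    rfl
  rw [h]
  exact Finset.sum_le_sum_of_subset_of_nonneg (Finset.subset_univ _) fun x _ _ ↦ hg x

/-- Inversion is a bijection of the unit group: `Σ_w g(w̄) = Σ_w g(w)`. [folklore] -/
theorem sum_units_inv_eq (g : ZMod c → ℝ) :
    ∑ w : (ZMod c)ˣ, g ((w⁻¹ : (ZMod c)ˣ) : ZMod c) = ∑ w : (ZMod c)ˣ, g (w : ZMod c) :=
  Fintype.sum_equiv (Equiv.inv (ZMod c)ˣ) _ _ fun _ ↦ rfl

/-! ## §3. The completion bound -/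

/-- **Opening the Kloosterman sums**: the bilinear form is `Σ_{w ∈ (ℤ/c)ˣ} A(w) B(w̄)` with the additive transforms
`A(x) = Σ_u α_u e(ux/c)`, `B(x) = Σ_v β_v e(vx/c)`. [folklore] -/
theorem bilinear_kloostermanSum_eq_sum_units (S T : Finset ℕ) (α β : ℕ → ℂ) :
    ∑ u ∈ S, ∑ v ∈ T, α u * β v * kloostermanSum c (u : ZMod c) (v : ZMod c) =
      ∑ w : (ZMod c)ˣ, (∑ u ∈ S, α u * (ZMod.stdAddChar ((u : ZMod c) * (w : ZMod c)) : ℂ)) *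
        (∑ v ∈ T, β v * (ZMod.stdAddChar ((v : ZMod c) * ((w⁻¹ : (ZMod c)ˣ) : ZMod c)) : ℂ)) := by
  calc ∑ u ∈ S, ∑ v ∈ T, α u * β v * kloostermanSum c (u : ZMod c) (v : ZMod c)
      = ∑ u ∈ S, ∑ v ∈ T, ∑ w : (ZMod c)ˣ, α u * β v *
          ((ZMod.stdAddChar ((u : ZMod c) * (w : ZMod c)) : ℂ) *
            (ZMod.stdAddChar ((v : ZMod c) * ((w⁻¹ : (ZMod c)ˣ) : ZMod c)) : ℂ)) := by
        refine Finset.sum_congr rfl fun u _ ↦ Finset.sum_congr rfl fun v _ ↦ ?_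
        rw [kloostermanSum_eq_sum_units, Finset.mul_sum]
        refine Finset.sum_congr rfl fun w _ ↦ ?_
        rw [AddChar.map_add_eq_mul]
    _ = ∑ w : (ZMod c)ˣ, ∑ u ∈ S, ∑ v ∈ T, α u * β v *
          ((ZMod.stdAddChar ((u : ZMod c) * (w : ZMod c)) : ℂ) *
            (ZMod.stdAddChar ((v : ZMod c) * ((w⁻¹ : (ZMod c)ˣ) : ZMod c)) : ℂ)) := by
        rw [Finset.sum_congr rfl fun u _ ↦ Finset.sum_comm]
        exact Finset.sum_comm
    _ = _ := by
        refine Finset.sum_congr rfl fun w _ ↦ ?_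
        rw [Finset.sum_mul_sum]
        refine Finset.sum_congr rfl fun u _ ↦ Finset.sum_congr rfl fun v _ ↦ ?_
        ring

/-- **THE FOURIER-THEORETIC (completion) BOUND for bilinear Kloosterman forms, any modulus `c ≥ 1`:** if the
`u ∈ S` are pairwise incongruent mod `c` and so are the `v ∈ T`, then
`‖Σ_{u∈S} Σ_{v∈T} α_u β_v S(u,v;c)‖ ≤ c · (Σ‖α_u‖²)^{1/2} · (Σ‖β_v‖²)^{1/2}`.
[cite: KerrShparlinskiWuXi2023, §1.1 (the trivial Fourier bound); Iwaniec2002, §2.5] -/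
theorem norm_bilinear_kloostermanSum_le (S T : Finset ℕ) (hS : Set.InjOn (fun u : ℕ ↦ (u : ZMod c)) S)
    (hT : Set.InjOn (fun v : ℕ ↦ (v : ZMod c)) T) (α β : ℕ → ℂ) :
    ‖∑ u ∈ S, ∑ v ∈ T, α u * β v * kloostermanSum c (u : ZMod c) (v : ZMod c)‖ ≤
      (c : ℝ) * Real.sqrt (∑ u ∈ S, ‖α u‖ ^ 2) * Real.sqrt (∑ v ∈ T, ‖β v‖ ^ 2) := by
  set A : ZMod c → ℂ := fun x ↦ ∑ u ∈ S, α u * (ZMod.stdAddChar ((u : ZMod c) * x) : ℂ) with hA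
  set B : ZMod c → ℂ := fun x ↦ ∑ v ∈ T, β v * (ZMod.stdAddChar ((v : ZMod c) * x) : ℂ) with hB
  have hopen : ∑ u ∈ S, ∑ v ∈ T, α u * β v * kloostermanSum c (u : ZMod c) (v : ZMod c) =
      ∑ w : (ZMod c)ˣ, A (w : ZMod c) * B ((w⁻¹ : (ZMod c)ˣ) : ZMod c) :=
    bilinear_kloostermanSum_eq_sum_units S T α β
  rw [hopen]
  -- triangle inequality and Cauchy–Schwarz over the units
  have h1 : ‖∑ w : (ZMod c)ˣ, A (w : ZMod c) * B ((w⁻¹ : (ZMod c)ˣ) : ZMod c)‖ ≤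
      ∑ w : (ZMod c)ˣ, ‖A (w : ZMod c)‖ * ‖B ((w⁻¹ : (ZMod c)ˣ) : ZMod c)‖ :=
    (norm_sum_le _ _).trans (le_of_eq (Finset.sum_congr rfl fun w _ ↦ norm_mul _ _))
  -- Cauchy–Schwarz with square roots over the unit group
  have hCS : ∀ f g : (ZMod c)ˣ → ℝ,
      ∑ i, f i * g i ≤ Real.sqrt (∑ i, f i ^ 2) * Real.sqrt (∑ i, g i ^ 2) := by
    intro f g
    have h := Finset.sum_mul_sq_le_sq_mul_sq (Finset.univ : Finset (ZMod c)ˣ) f g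
    have h1 : ∑ i, f i * g i ≤ |∑ i, f i * g i| := le_abs_self _
    rw [← Real.sqrt_sq_eq_abs] at h1
    refine h1.trans ?_
    rw [← Real.sqrt_mul (Finset.sum_nonneg fun i _ ↦ sq_nonneg (f i))]
    exact Real.sqrt_le_sqrt h
  have h2 := hCS (fun w : (ZMod c)ˣ ↦ ‖A (w : ZMod c)‖) (fun w : (ZMod c)ˣ ↦ ‖B ((w⁻¹ : (ZMod c)ˣ) : ZMod c)‖)
  -- the two unit sums are at most the complete sums, which Plancherel evaluates
  have hAle : ∑ w : (ZMod c)ˣ, ‖A (w : ZMod c)‖ ^ 2 ≤ (c : ℝ) * ∑ u ∈ S, ‖α u‖ ^ 2 := by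
    rw [← sum_norm_sq_natTransform_eq S hS α]
    exact sum_units_le_sum (g := fun x ↦ ‖A x‖ ^ 2) fun x ↦ sq_nonneg _
  have hBle : ∑ w : (ZMod c)ˣ, ‖B ((w⁻¹ : (ZMod c)ˣ) : ZMod c)‖ ^ 2 ≤ (c : ℝ) * ∑ v ∈ T, ‖β v‖ ^ 2 := by
    rw [sum_units_inv_eq (fun x ↦ ‖B x‖ ^ 2), ← sum_norm_sq_natTransform_eq T hT β]
    exact sum_units_le_sum (g := fun x ↦ ‖B x‖ ^ 2) fun x ↦ sq_nonneg _
  have hc0 : (0 : ℝ) ≤ c := Nat.cast_nonneg c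
  have hα0 : 0 ≤ ∑ u ∈ S, ‖α u‖ ^ 2 := Finset.sum_nonneg fun _ _ ↦ sq_nonneg _
  have hβ0 : 0 ≤ ∑ v ∈ T, ‖β v‖ ^ 2 := Finset.sum_nonneg fun _ _ ↦ sq_nonneg _
  calc ‖∑ w : (ZMod c)ˣ, A (w : ZMod c) * B ((w⁻¹ : (ZMod c)ˣ) : ZMod c)‖
      ≤ ∑ w : (ZMod c)ˣ, ‖A (w : ZMod c)‖ * ‖B ((w⁻¹ : (ZMod c)ˣ) : ZMod c)‖ := h1
    _ ≤ Real.sqrt (∑ w : (ZMod c)ˣ, ‖A (w : ZMod c)‖ ^ 2) *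
          Real.sqrt (∑ w : (ZMod c)ˣ, ‖B ((w⁻¹ : (ZMod c)ˣ) : ZMod c)‖ ^ 2) := h2
    _ ≤ Real.sqrt ((c : ℝ) * ∑ u ∈ S, ‖α u‖ ^ 2) * Real.sqrt ((c : ℝ) * ∑ v ∈ T, ‖β v‖ ^ 2) :=
        mul_le_mul (Real.sqrt_le_sqrt hAle) (Real.sqrt_le_sqrt hBle) (Real.sqrt_nonneg _) (Real.sqrt_nonneg _)
    _ = (c : ℝ) * Real.sqrt (∑ u ∈ S, ‖α u‖ ^ 2) * Real.sqrt (∑ v ∈ T, ‖β v‖ ^ 2) := by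
        rw [Real.sqrt_mul hc0, Real.sqrt_mul hc0,
          show Real.sqrt c * Real.sqrt (∑ u ∈ S, ‖α u‖ ^ 2) * (Real.sqrt c * Real.sqrt (∑ v ∈ T, ‖β v‖ ^ 2)) =
            (Real.sqrt c * Real.sqrt c) * Real.sqrt (∑ u ∈ S, ‖α u‖ ^ 2) * Real.sqrt (∑ v ∈ T, ‖β v‖ ^ 2) by ring,
          Real.mul_self_sqrt hc0]

/-- **The completion bound on initial segments**: for `U, V ≤ c`,
`‖Σ_{u ≤ U} Σ_{v ≤ V} α_u β_v S(u,v;c)‖ ≤ c ‖α‖₂ ‖β‖₂` — the «Parseval floor» of deck 21c for one Petersson modulus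
`c = q r`, in the balanced variables `u = m₁'m₂' ≤ q̂^{2Δ'}`, `v = n₁'n₂'`. [cite: KerrShparlinskiWuXi2023, §1.1] -/
theorem norm_bilinear_kloostermanSum_Icc_le {U V : ℕ} (hU : U ≤ c) (hV : V ≤ c) (α β : ℕ → ℂ) :
    ‖∑ u ∈ Icc 1 U, ∑ v ∈ Icc 1 V, α u * β v * kloostermanSum c (u : ZMod c) (v : ZMod c)‖ ≤
      (c : ℝ) * Real.sqrt (∑ u ∈ Icc 1 U, ‖α u‖ ^ 2) * Real.sqrt (∑ v ∈ Icc 1 V, ‖β v‖ ^ 2) :=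
  norm_bilinear_kloostermanSum_le _ _ (injOn_natCast_Icc hU) (injOn_natCast_Icc hV) α β

end Summit.Parity.GeneralizedHardyLittlewood.Theorems.MomentsBeyondDiagonal.Layers

end
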